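import Summits.QuantumFields.YangMills.Theorems.LogConcaveChartTransportGrowth
import Summits.QuantumFields.YangMills.Theorems.LogConcaveChartTransportRemainderDeriv

/-!
# Route `LogConcaveChart` — toolkit for the support item `TransportCovarianceTransfer`
(stmt-QuantumFields-23668, child of the transport split of crux `QuadraticCovarianceComparison`,
stmt-QuantumFields-26240): **dimension-free variance of the transport remainder**

Isotropic frame `γ = 𝒩(0, I_n)`.  For `q(y) = yᵀHy + b·y` (`H` symmetric) and a `C¹` map `T` with
`|DT − I| ≤ δ` pointwise, `T − id` `δ`-Lipschitz and `γ`-centred displacement (`∫ (T − id) dγ = 0`),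
`0 ≤ δ ≤ 1/2`:

  `Var_γ (q ∘ T − q) ≤ (3π² + π⁴/4) · δ² · (‖H‖_F² + |b|²)`   (`variance_remainder_le`).

No factor of the dimension `n` appears: the proof is Poincaré (dominated-gradient form) on the single
function `R = q ∘ T − q`, whose squared gradient is dominated by
`24δ²|Hx|² + (24δ² + 8)|H(Tx − x)|² + 6δ²|b|²`, and `∫|H(T − id)|² dγ ≤ (π²/8)δ²‖H‖_F²` is the
row-wise Poincaré bound (centred displacement).  This is step (3) of the transport proof of the
covariance comparison; the Gaussian side (`Cov_γ(q_f, q_g) = rC`) is `covariance_quadObs_pi`.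

HONEST SCOPE. Helper lemmas toward ONE support item of a sub-line; nothing here proves
`TransportCovarianceTransfer`, `QuadraticCovarianceComparison`, the `LogConcaveChart` thesis, rung
R2a (`BalabanLadder.NT`) or any summit statement; the Yang–Mills mass gap is NOT proved.
Filed by ideator seat ym-idea-8 (generation 8, lens «dual» = transport side).
-/

namespace Summit.QuantumFields.YangMills.Cruxes.TransportCovarianceTransfer

open MeasureTheory ProbabilityTheory
open scoped NNReal ENNReal

variable {n : ℕ}

/-- The Lipschitz hypothesis on `T − id`, rewritten for the displacement `e = T − id`. [folklore] -/
theorem displacement_lipschitz {δ : ℝ} {T : (Fin n → ℝ) → (Fin n → ℝ)}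
    (hLip : ∀ x y, (T x - T y - (x - y)) ⬝ᵥ (T x - T y - (x - y)) ≤ δ ^ 2 * ((x - y) ⬝ᵥ (x - y)))
    (x y : Fin n → ℝ) :
    ((T x - x) - (T y - y)) ⬝ᵥ ((T x - x) - (T y - y)) ≤ δ ^ 2 * ((x - y) ⬝ᵥ (x - y)) := by
  have e : (T x - x) - (T y - y) = T x - T y - (x - y) := by abel
  rw [e]
  exact hLip x y

/-- The derivative bound `|DT − I| ≤ δ`, rewritten for the displacement `e = T − id`. [folklore] -/
theorem displacement_fderiv_bound {δ : ℝ} {T : (Fin n → ℝ) → (Fin n → ℝ)} (hT : ContDiff ℝ 1 T)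
    (hD : ∀ x u : Fin n → ℝ, (fderiv ℝ T x u - u) ⬝ᵥ (fderiv ℝ T x u - u) ≤ δ ^ 2 * (u ⬝ᵥ u))
    (x u : Fin n → ℝ) :
    fderiv ℝ (fun y : Fin n → ℝ => T y - y) x u ⬝ᵥ fderiv ℝ (fun y : Fin n → ℝ => T y - y) x u ≤
      δ ^ 2 * (u ⬝ᵥ u) := by
  rw [fderiv_displacement hT]
  exact hD x u

/-- `∫ |Hx|² dγ = ‖H‖_F²` (with integrability). [folklore] -/
theorem integral_mulVec_sq_pi (H : Matrix (Fin n) (Fin n) ℝ) :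
    Integrable (fun x : Fin n → ℝ => H.mulVec x ⬝ᵥ H.mulVec x)
        (Measure.pi fun _ : Fin n => gaussianReal 0 1) ∧
      ∫ x, H.mulVec x ⬝ᵥ H.mulVec x ∂(Measure.pi fun _ : Fin n => gaussianReal 0 1) =
        ∑ i, ∑ j, H i j ^ 2 := by
  have e : (fun x : Fin n → ℝ => H.mulVec x ⬝ᵥ H.mulVec x) =
      fun x => ∑ i, (H i ⬝ᵥ x) * (H i ⬝ᵥ x) := by
    funext x
    rfl
  have h := fun i : Fin n => integral_dotProduct_mul_dotProduct_pi (n := n) (H i) (H i)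
  rw [e]
  refine ⟨integrable_finsetSum _ fun i _ => (h i).1, ?_⟩
  rw [integral_finsetSum _ fun i _ => (h i).1]
  refine Finset.sum_congr rfl fun i _ => ?_
  rw [(h i).2]
  simp only [dotProduct, sq]

/-- `∫ |H(T − id)|² dγ ≤ (π²/8)δ²‖H‖_F²` for centred displacement (with integrability): the row-wise
Poincaré bound of `LogConcaveChartTransportPoincare`, restated for `T`. [folklore] -/
theorem integral_mulVec_displacement_sq_le' {δ : ℝ} {T : (Fin n → ℝ) → (Fin n → ℝ)}
    (hT : ContDiff ℝ 1 T)
    (hD : ∀ x u : Fin n → ℝ, (fderiv ℝ T x u - u) ⬝ᵥ (fderiv ℝ T x u - u) ≤ δ ^ 2 * (u ⬝ᵥ u))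
    (hLip : ∀ x y, (T x - T y - (x - y)) ⬝ᵥ (T x - T y - (x - y)) ≤ δ ^ 2 * ((x - y) ⬝ᵥ (x - y)))
    (hc : ∀ i, ∫ x, (T x - x) i ∂(Measure.pi fun _ : Fin n => gaussianReal 0 1) = 0)
    (H : Matrix (Fin n) (Fin n) ℝ) :
    Integrable (fun x : Fin n → ℝ => H.mulVec (T x - x) ⬝ᵥ H.mulVec (T x - x))
        (Measure.pi fun _ : Fin n => gaussianReal 0 1) ∧
      ∫ x, H.mulVec (T x - x) ⬝ᵥ H.mulVec (T x - x) ∂(Measure.pi fun _ : Fin n => gaussianReal 0 1) ≤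
        Real.pi ^ 2 / 8 * (δ ^ 2 * ∑ i, ∑ j, H i j ^ 2) := by
  have he : ContDiff ℝ 1 (fun y : Fin n → ℝ => T y - y) := contDiff_displacement hT
  have hD' := displacement_fderiv_bound hT hD
  have hLip' := displacement_lipschitz hLip
  refine ⟨?_, integral_mulVec_displacement_sq_le he hD' hLip' hc H⟩
  have e : (fun x : Fin n → ℝ => H.mulVec (T x - x) ⬝ᵥ H.mulVec (T x - x)) =
      fun x => ∑ i, (H i ⬝ᵥ (T x - x)) ^ 2 := by
    funext x
    simp only [sq]
    rfl
  rw [e]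
  exact integrable_finsetSum _ fun i _ =>
    (integrable_dotProduct_displacement he.continuous hLip' (H i)).2

/-- The arithmetic of the remainder constant: with `p = π²`, `d = δ² ≤ 1/4`,
`(p/8)(24dF + (24d + 8)P + 6dB) ≤ (3p + p²/4) d (F + B)` whenever `0 ≤ P ≤ (p/8) d F`. [folklore] -/
theorem remainder_constant_arith {p d F B P : ℝ} (hp : 0 ≤ p) (hd : 0 ≤ d) (hd4 : d ≤ 1 / 4)
    (hF : 0 ≤ F) (hB : 0 ≤ B) (hP : 0 ≤ P) (hPle : P ≤ p / 8 * (d * F)) :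
    p / 8 * (24 * d * F + (24 * d + 8) * P + 6 * d * B) ≤ (3 * p + p ^ 2 / 4) * d * (F + B) := by
  have h1 : 3 * p * d * P ≤ 3 * p * d * (p / 8 * (d * F)) :=
    mul_le_mul_of_nonneg_left hPle (by positivity)
  have h2 : p * P ≤ p * (p / 8 * (d * F)) := mul_le_mul_of_nonneg_left hPle hp
  have h3 : 3 * p * d * (p / 8 * (d * F)) ≤ 3 * p * (1 / 4) * (p / 8 * (d * F)) := by
    have : 0 ≤ 3 * p * (p / 8 * (d * F)) := by positivity
    nlinarith
  nlinarith [h1, h2, h3, mul_nonneg hp hB, mul_nonneg (mul_nonneg hp hp) (mul_nonneg hd hB),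
    mul_nonneg (mul_nonneg hp hd) hB]

/-- **Dimension-free variance of the transport remainder.** For symmetric `H`, `0 ≤ δ ≤ 1/2`, a `C¹`
map `T` with `|DT(x)u − u|² ≤ δ²|u|²`, `T − id` `δ`-Lipschitz and `∫ (T − id) dγ = 0`:
`Var_γ(q_{H,b} ∘ T − q_{H,b}) ≤ (3π² + π⁴/4) δ² (‖H‖_F² + |b|²)`. [folklore] -/
theorem variance_remainder_le {δ : ℝ} (hδ : 0 ≤ δ) (hδ1 : δ ≤ 1 / 2)
    {H : Matrix (Fin n) (Fin n) ℝ} (hH : H.IsSymm) (b : Fin n → ℝ)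
    {T : (Fin n → ℝ) → (Fin n → ℝ)} (hT : ContDiff ℝ 1 T)
    (hD : ∀ x u : Fin n → ℝ, (fderiv ℝ T x u - u) ⬝ᵥ (fderiv ℝ T x u - u) ≤ δ ^ 2 * (u ⬝ᵥ u))
    (hLip : ∀ x y, (T x - T y - (x - y)) ⬝ᵥ (T x - T y - (x - y)) ≤ δ ^ 2 * ((x - y) ⬝ᵥ (x - y)))
    (hc : ∀ i, ∫ x, (T x - x) i ∂(Measure.pi fun _ : Fin n => gaussianReal 0 1) = 0) :
    ∫ x, ((T x ⬝ᵥ H.mulVec (T x) + b ⬝ᵥ T x) - (x ⬝ᵥ H.mulVec x + b ⬝ᵥ x)) ^ 2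
        ∂(Measure.pi fun _ : Fin n => gaussianReal 0 1) -
      (∫ x, (T x ⬝ᵥ H.mulVec (T x) + b ⬝ᵥ T x) - (x ⬝ᵥ H.mulVec x + b ⬝ᵥ x)
        ∂(Measure.pi fun _ : Fin n => gaussianReal 0 1)) ^ 2 ≤
      (3 * Real.pi ^ 2 + Real.pi ^ 4 / 4) * δ ^ 2 * ((∑ i, ∑ j, H i j ^ 2) + b ⬝ᵥ b) := by
  set γ : Measure (Fin n → ℝ) := Measure.pi fun _ : Fin n => gaussianReal 0 1 with hγ
  -- integrability of the remainder and of its square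
  obtain ⟨i1T, i2T⟩ := integrable_quadObs_comp hT.continuous hLip H b
  obtain ⟨i1, i2⟩ := integrable_quadObs (n := n) H b
  have h1 : Integrable (fun x : Fin n → ℝ =>
      (T x ⬝ᵥ H.mulVec (T x) + b ⬝ᵥ T x) - (x ⬝ᵥ H.mulVec x + b ⬝ᵥ x)) γ := i1T.sub i1
  have h2 : Integrable (fun x : Fin n → ℝ =>
      ((T x ⬝ᵥ H.mulVec (T x) + b ⬝ᵥ T x) - (x ⬝ᵥ H.mulVec x + b ⬝ᵥ x)) ^ 2) γ :=
    integrable_sq_sub_of_sq (continuous_quadObs_comp hT.continuous H b)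
      (continuous_quadObs_comp (T := fun z => z) continuous_id H b) i2T i2
  -- the dominating function
  obtain ⟨iX, hX⟩ := integral_mulVec_sq_pi (n := n) H
  obtain ⟨iE, hE⟩ := integral_mulVec_displacement_sq_le' hT hD hLip hc H
  set F : ℝ := ∑ i, ∑ j, H i j ^ 2 with hF
  set X : (Fin n → ℝ) → ℝ := fun x => H.mulVec x ⬝ᵥ H.mulVec x with hXdef
  set E : (Fin n → ℝ) → ℝ := fun x => H.mulVec (T x - x) ⬝ᵥ H.mulVec (T x - x) with hEdef
  set g : (Fin n → ℝ) → ℝ :=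
    fun x => 24 * δ ^ 2 * X x + ((24 * δ ^ 2 + 8) * E x + 6 * δ ^ 2 * (b ⬝ᵥ b)) with hg
  have hX0 : ∀ x, 0 ≤ X x := fun x => Finset.sum_nonneg fun _ _ => mul_self_nonneg _
  have hE0 : ∀ x, 0 ≤ E x := fun x => Finset.sum_nonneg fun _ _ => mul_self_nonneg _
  have hB0 : 0 ≤ b ⬝ᵥ b := Finset.sum_nonneg fun _ _ => mul_self_nonneg _
  have hg0 : ∀ x, 0 ≤ g x := fun x => by
    simp only [hg]
    have := hX0 x
    have := hE0 x
    positivity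
  have iE' : Integrable (fun x => (24 * δ ^ 2 + 8) * E x + 6 * δ ^ 2 * (b ⬝ᵥ b)) γ :=
    (iE.const_mul _).add (integrable_const _)
  have hgi : Integrable g γ := (iX.const_mul _).add iE'
  have hdom : ∀ x, ∑ i, (fderiv ℝ (fun y : Fin n → ℝ =>
      (T y ⬝ᵥ H.mulVec (T y) + b ⬝ᵥ T y) - (y ⬝ᵥ H.mulVec y + b ⬝ᵥ y)) x (Pi.single i 1)) ^ 2 ≤
        g x := fun x => by
    have h := sum_sq_fderiv_remainder_le' hH b hT hD x
    simp only [hg, hXdef, hEdef]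
    linarith
  have hvar := variance_le_of_dominated_gradient (contDiff_remainder H b hT) h1 h2 hg0 hgi hdom
  -- ∫ g dγ
  have hIg : ∫ x, g x ∂γ = 24 * δ ^ 2 * F +
      ((24 * δ ^ 2 + 8) * ∫ x, E x ∂γ + 6 * δ ^ 2 * (b ⬝ᵥ b)) := by
    simp only [hg]
    rw [integral_add (iX.const_mul _) iE', integral_add (iE.const_mul _) (integrable_const _),
      integral_const_mul, integral_const_mul, integral_const, hX]
    simp
    exact Or.inl rfl
  rw [hIg] at hvar
  have harith := remainder_constant_arith (p := Real.pi ^ 2) (d := δ ^ 2) (F := F) (B := b ⬝ᵥ b)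
    (P := ∫ x, E x ∂γ) (by positivity) (by positivity) (by nlinarith)
    (Finset.sum_nonneg fun i _ => Finset.sum_nonneg fun j _ => sq_nonneg _) hB0
    (integral_nonneg hE0) hE
  have e4 : Real.pi ^ 4 = (Real.pi ^ 2) ^ 2 := by ring
  rw [e4]
  linarith [hvar, harith]

end Summit.QuantumFields.YangMills.Cruxes.TransportCovarianceTransfer
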